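import Mathlib
import Summits.Ventures.PercRepro2.Defs
import Summits.Ventures.PercRepro2.Independence
import Summits.Ventures.PercRepro2.Harris
import Summits.Ventures.PercRepro2.ThreeEventSafe
import Summits.Ventures.PercRepro2.ThreeEventCross

/-!
# Pointwise certificates for the cross term (blind cell PercRepro2, p4 g33; proofs/P4-G33-CROSS.md §0, §4)

The covariance defect `Ψ_p = Cov_p(G, H) − Cov_p(M, B ∩ H)` is a double sum over two independent
samples: `Ψ_p = Σ_{ω, ω'} w_p(ω) w_p(ω') · c(ω, ω')` with the PAIR WEIGHT
`c(ω, ω') = 1_{G∩H}(ω') − 1_{M∩B∩H}(ω') − 1_G(ω) 1_H(ω') + 1_M(ω) 1_{B∩H}(ω')`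
(`defect_eq_double_sum`). The cross term of the pinning step at `e` is the same double sum, under
`p[e↦1]`, of the CROSS PAIR WEIGHT `χ(ω, ω') = c(ω[e↦0], ω') + c(ω, ω'[e↦0])` (`crossTerm_eq_double_sum`).
**`crossTerm_ge_of_pointwise`**: if `χ ≥ λ₁ c₁ + λ₂ c₂` pointwise on the configurations with `e` open,
for the pair weights `c₁, c₂` of two further quadruples (`λ₁, λ₂ ≥ 0`), then
`X_p(e) ≥ λ₁ Ψ_{p[e↦1]}(quadruple 1) + λ₂ Ψ_{p[e↦1]}(quadruple 2)` — so a pointwise certificate built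
from admissible instances (whose defects are nonnegative by the induction hypothesis) gives
`X_p(e) ≥ 0`, the hypothesis of `cov_inter_le_cov_of_cross`. No instance, no notation.
-/

namespace Summit.Ventures.PercRepro2

namespace ThreeEvent

section DoubleSum

variable {E : Type*} [Fintype E] [DecidableEq E] {R : Type*} [CommRing R]

/-- The pair weight of a quadruple: `c(ω, ω') = 1_{G∩H}(ω') − 1_{M∩(B∩H)}(ω') − 1_G(ω)·1_H(ω')
+ 1_M(ω)·1_{B∩H}(ω')` (the G-sample `ω`, the H-sample `ω'`). -/
noncomputable def pairWt (G H M B : Set (Config E)) (ω ω' : Config E) : R :=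
  (G ∩ H).indicator (1 : Config E → R) ω' - (M ∩ (B ∩ H)).indicator 1 ω'
    - G.indicator 1 ω * H.indicator 1 ω' + M.indicator 1 ω * (B ∩ H).indicator 1 ω'

/-- A probability as a double sum with a dummy first sample. -/
lemma prob_eq_double_sum (p : E → R) (X : Set (Config E)) :
    prob p X = ∑ ω, ∑ ω', weight p ω * weight p ω' * X.indicator (1 : Config E → R) ω' := by
  rw [prob_eq_expect_indicator]
  unfold expect
  have : ∑ ω, ∑ ω', weight p ω * weight p ω' * X.indicator (1 : Config E → R) ω'
      = (∑ ω, weight p ω) * ∑ ω', weight p ω' * X.indicator (1 : Config E → R) ω' := by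
    rw [Finset.sum_mul_sum]
    simp only [mul_assoc]
  rw [this, sum_weight, one_mul]

/-- A product of two probabilities as a double sum. -/
lemma prob_mul_prob_eq_double_sum (p q : E → R) (X Y : Set (Config E)) :
    prob p X * prob q Y
      = ∑ ω, ∑ ω', weight p ω * weight q ω' * (X.indicator (1 : Config E → R) ω
          * Y.indicator 1 ω') := by
  rw [prob_eq_expect_indicator, prob_eq_expect_indicator]
  unfold expect
  rw [Finset.sum_mul_sum]
  refine Finset.sum_congr rfl fun ω _ => Finset.sum_congr rfl fun ω' _ => ?_
  ring

/-- A probability under `q` as a double sum whose dummy first sample is taken under `p`. -/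
lemma prob_eq_double_sum' (p q : E → R) (X : Set (Config E)) :
    prob q X = ∑ ω, ∑ ω', weight p ω * weight q ω' * X.indicator (1 : Config E → R) ω' := by
  rw [prob_eq_expect_indicator]
  unfold expect
  have : ∑ ω, ∑ ω', weight p ω * weight q ω' * X.indicator (1 : Config E → R) ω'
      = (∑ ω, weight p ω) * ∑ ω', weight q ω' * X.indicator (1 : Config E → R) ω' := by
    rw [Finset.sum_mul_sum]
    simp only [mul_assoc]
  rw [this, sum_weight, one_mul]

/-- **The defect as a double sum over two independent samples.** -/
theorem defect_eq_double_sum (p : E → R) (G H M B : Set (Config E)) :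
    defect p G H M B = ∑ ω, ∑ ω', weight p ω * weight p ω' * pairWt G H M B ω ω' := by
  unfold defect
  rw [prob_eq_double_sum p (G ∩ H), prob_eq_double_sum p (M ∩ (B ∩ H)),
    prob_mul_prob_eq_double_sum p p G H, prob_mul_prob_eq_double_sum p p M (B ∩ H)]
  simp only [pairWt, ← Finset.sum_sub_distrib]
  refine Finset.sum_congr rfl fun ω _ => Finset.sum_congr rfl fun ω' _ => ?_
  ring

/-- The first half `Q(0,1)` of the cross term (H-sample under `p[e↦1]`, G-sample under `p[e↦0]`)
as a double sum. -/
lemma crossQ_eq_double_sum (p q : E → R) (G H M B : Set (Config E)) :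
    prob q (G ∩ H) - prob q (M ∩ (B ∩ H)) - prob q H * prob p G + prob q (B ∩ H) * prob p M
      = ∑ ω, ∑ ω', weight p ω * weight q ω' * pairWt G H M B ω ω' := by
  rw [prob_eq_double_sum' p q (G ∩ H), prob_eq_double_sum' p q (M ∩ (B ∩ H)),
    mul_comm (prob q H) (prob p G), mul_comm (prob q (B ∩ H)) (prob p M),
    prob_mul_prob_eq_double_sum p q G H, prob_mul_prob_eq_double_sum p q M (B ∩ H)]
  simp only [pairWt, ← Finset.sum_sub_distrib, ← Finset.sum_add_distrib]
  refine Finset.sum_congr rfl fun ω _ => Finset.sum_congr rfl fun ω' _ => ?_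
  ring

/-- Pinning closed: the weight of a configuration equals the weight, pinned open, of the
configuration with `e` forced open (both are the product over the other edges). -/
lemma weight_update_zero_eq_weight_update_one (p : E → R) (e : E) (ω : Config E) :
    weight (Function.update p e 0) ω
      = (if ω e = false then (1 : R) else 0)
        * weight (Function.update p e 1) (Function.update ω e true) := by
  unfold weight
  rw [← Finset.mul_prod_erase Finset.univ _ (Finset.mem_univ e),
    ← Finset.mul_prod_erase Finset.univ _ (Finset.mem_univ e)]
  have hrest : ∏ x ∈ Finset.univ.erase e, edgeFactor (Function.update p e 0 x) (ω x)
      = ∏ x ∈ Finset.univ.erase e,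
          edgeFactor (Function.update p e 1 x) (Function.update ω e true x) := by
    refine Finset.prod_congr rfl fun x hx => ?_
    have hx' : x ≠ e := Finset.ne_of_mem_erase hx
    rw [Function.update_of_ne hx', Function.update_of_ne hx', Function.update_of_ne hx']
  rw [hrest, Function.update_self, Function.update_self, Function.update_self]
  cases h : ω e <;> simp [edgeFactor]

/-- The sum of a function against the weights pinned closed equals the sum, against the weights
pinned open, of the function with `e` forced closed. -/
lemma sum_weight_update_zero_mul (p : E → R) (e : E) (f : Config E → R) :
    ∑ ω, weight (Function.update p e 0) ω * f ω
      = ∑ ω, weight (Function.update p e 1) ω * f (Function.update ω e false) := by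
  have h := expect_update_zero p f e
  have h' := expect_update_one p (fun ω => f (Function.update ω e false)) e
  simp only [expect, Function.update_idem] at h h'
  rw [h, h']

/-- **The cross term as a double sum under `p[e↦1]`**:
`X_p(e) = Σ_{ω, ω'} w₁(ω) w₁(ω') · (c(ω[e↦0], ω') + c(ω, ω'[e↦0]))`. -/
theorem crossTerm_eq_double_sum (p : E → R) (e : E) (G H M B : Set (Config E)) :
    crossTerm p e G H M B
      = ∑ ω, ∑ ω', weight (Function.update p e 1) ω * weight (Function.update p e 1) ω'
          * (pairWt G H M B (Function.update ω e false) ω'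
              + pairWt G H M B ω (Function.update ω' e false)) := by
  rw [crossTerm_eq]
  rw [crossQ_eq_double_sum (Function.update p e 0) (Function.update p e 1) G H M B,
    crossQ_eq_double_sum (Function.update p e 1) (Function.update p e 0) G H M B]
  -- first sum: move the G-sample from `p[e↦0]` to `p[e↦1]`
  have h1 : ∑ ω, ∑ ω', weight (Function.update p e 0) ω * weight (Function.update p e 1) ω'
        * pairWt G H M B ω ω'
      = ∑ ω, ∑ ω', weight (Function.update p e 1) ω * weight (Function.update p e 1) ω'
        * pairWt G H M B (Function.update ω e false) ω' := by
    have := sum_weight_update_zero_mul p e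
      (fun ω => ∑ ω', weight (Function.update p e 1) ω' * pairWt G H M B ω ω')
    simp only [Finset.mul_sum] at this ⊢
    convert this using 1 <;> refine Finset.sum_congr rfl fun ω _ => Finset.sum_congr rfl fun ω' _ => ?_
    <;> ring
  -- second sum: move the H-sample from `p[e↦0]` to `p[e↦1]`
  have h2 : ∑ ω, ∑ ω', weight (Function.update p e 1) ω * weight (Function.update p e 0) ω'
        * pairWt G H M B ω ω'
      = ∑ ω, ∑ ω', weight (Function.update p e 1) ω * weight (Function.update p e 1) ω'
        * pairWt G H M B ω (Function.update ω' e false) := by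
    refine Finset.sum_congr rfl fun ω _ => ?_
    have := sum_weight_update_zero_mul p e (fun ω' => weight (Function.update p e 1) ω
      * pairWt G H M B ω ω')
    convert this using 1 <;> refine Finset.sum_congr rfl fun ω' _ => ?_ <;> ring
  rw [h1, h2, ← Finset.sum_add_distrib]
  refine Finset.sum_congr rfl fun ω _ => ?_
  rw [← Finset.sum_add_distrib]
  refine Finset.sum_congr rfl fun ω' _ => ?_
  ring

/-- Pinned open, the weight vanishes on configurations where `e` is closed. -/
lemma weight_update_one_eq_zero_of_false (p : E → R) {ω : Config E} {e : E}
    (h : ω e = false) : weight (Function.update p e 1) ω = 0 :=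
  weight_update_one_of_eq_false p h

end DoubleSum

section Certificate

variable {E : Type*} [Fintype E] [DecidableEq E] {R : Type*} [CommRing R] [LinearOrder R]
  [IsStrictOrderedRing R]

/-- **Pointwise certificates for the cross term.** If, on configurations with `e` open,
`χ(ω, ω') ≥ λ₁ c₁(ω, ω') + λ₂ c₂(ω, ω')` for the pair weights `c₁, c₂` of two quadruples and any
reals `λ₁, λ₂`, then `X_p(e) ≥ λ₁ Ψ_{p[e↦1]}(quadruple 1) + λ₂ Ψ_{p[e↦1]}(quadruple 2)`. -/
theorem crossTerm_ge_of_pointwise {p : E → R} (hp : IsProbVec p) (e : E)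
    (G H M B G₁ H₁ M₁ B₁ G₂ H₂ M₂ B₂ : Set (Config E)) (l₁ l₂ : R)
    (hcert : ∀ ω ω' : Config E, ω e = true → ω' e = true →
      l₁ * pairWt G₁ H₁ M₁ B₁ ω ω' + l₂ * pairWt G₂ H₂ M₂ B₂ ω ω'
        ≤ pairWt G H M B (Function.update ω e false) ω'
          + pairWt G H M B ω (Function.update ω' e false)) :
    l₁ * defect (Function.update p e 1) G₁ H₁ M₁ B₁
      + l₂ * defect (Function.update p e 1) G₂ H₂ M₂ B₂ ≤ crossTerm p e G H M B := by
  rw [crossTerm_eq_double_sum, defect_eq_double_sum, defect_eq_double_sum]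
  simp only [Finset.mul_sum]
  rw [← Finset.sum_add_distrib]
  refine Finset.sum_le_sum fun ω _ => ?_
  rw [← Finset.sum_add_distrib]
  refine Finset.sum_le_sum fun ω' _ => ?_
  have hq : IsProbVec (Function.update p e 1) := hp.update e zero_le_one le_rfl
  have hw : 0 ≤ weight (Function.update p e 1) ω * weight (Function.update p e 1) ω' :=
    mul_nonneg (weight_nonneg hq ω) (weight_nonneg hq ω')
  by_cases h : ω e = true
  · by_cases h' : ω' e = true
    · have := mul_le_mul_of_nonneg_left (hcert ω ω' h h') hw
      linarith [this]
    · have h'' : ω' e = false := by simpa using h'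
      rw [weight_update_one_eq_zero_of_false p h'']
      simp
  · have h'' : ω e = false := by simpa using h
    rw [weight_update_one_eq_zero_of_false p h'']
    simp

end Certificate

end ThreeEvent

end Summit.Ventures.PercRepro2
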